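import Summits.QuantumFields.YangMills.Theorems.SmallFieldWideningWindowCondCauchyCouplingIff

/-!
# Route SmallFieldWidening, crux `WindowCondCauchy` (stmt-QuantumFields-27825), line «via-tv» — COMPOSITION OF COUPLINGS WITHOUT
# GLUING (the critic's «K-fold composition lemma», transport-agnostic)

LINE g6-C (planner ym-idea-1 g6).  The critic idea-crit-4 g4 (n6, 2026-08-28T13:08:48Z) asks that, once a level transport lets the one-step
comparison `ν_K ↝ ν_{K+1}` of the conditioned unit laws be split into intermediate comparisons, the «K-fold composition lemma (gluing of
couplings)» be landed sorry-free FIRST, leaving only a one-LEVEL coupling as the XL stub.  This file lands that composition NOW, in a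
form that needs neither the transport nor a gluing/disintegration lemma: couplings compose THROUGH THE EVENT CURRENCY of
`…CouplingIff` (p637638/p637950) — a coupling bounds every event increment by its bad mass (sharp), the increments telescope, and the
maximal coupling (`exists_coupling_of_measureReal_sub_le`) turns the telescoped bound back into a coupling, with NO loss
(`Σ b_j`, exactly what gluing would give).

* `measureReal_sub_le_of_coupling` — a finite measure `π` on `X × X` with marginals `μ`, `ν` and bad set `B ⊇ {x ≠ y}` gives
  `μ(A) − ν(A) ≤ π(B)` for every measurable `A` (`B` need not be measurable).
* `exists_coupling_chain` — probability laws `ρ_0, …, ρ_n` (any `ℕ`-indexed chain on a space with measurable diagonal), consecutive ones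
  coupled with bad masses `≤ b_j` (`j < n`) ⇒ a probability coupling of `ρ_0`, `ρ_n` with off-diagonal mass `≤ Σ_{j<n} b_j`.
* `exists_coupling_chain_unitSpace` — the instance on the unit field space `SU(2)^{bonds}` of a family (measurable diagonal supplied).

Pure measure theory; nothing of the RG content; no summit statement is touched (R3 RECORD rung; the Yang–Mills mass gap is NOT proved).
-/

set_option autoImplicit false
open MeasureTheory Set
open Literature.MathematicalPhysics.QuantumFieldTheory.Balaban1983to89
open Literature.MathematicalPhysics.QuantumFieldTheory.Balaban1983to89.T3ContinuumYM3Torus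

namespace Summit.QuantumFields.YangMills.Theorems.WindowCondCauchyCoupling

section Chain

variable {X : Type*} [MeasurableSpace X]

/-- **A COUPLING BOUNDS THE EVENT INCREMENTS, SHARP FORM**: if a finite measure `π` on `X × X` has marginals `μ`, `ν` and its bad set
`B` contains every off-diagonal point, then `μ(A) − ν(A) ≤ π(B)` for every measurable `A` (`A × X ⊆ X × A ∪ B`; `B` need not be
measurable). (Folklore.) -/
theorem measureReal_sub_le_of_coupling (μ ν : Measure X) (π : Measure (X × X)) (B : Set (X × X)) [IsFiniteMeasure π]
    (h1 : π.map Prod.fst = μ) (h2 : π.map Prod.snd = ν) (hBd : ∀ p, p ∉ B → p.1 = p.2) {A : Set X} (hA : MeasurableSet A) :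
    μ.real A - ν.real A ≤ (π B).toReal := by
  have hμA : μ.real A = π.real (Prod.fst ⁻¹' A) := by
    rw [← h1, measureReal_def, measureReal_def, Measure.map_apply measurable_fst hA]
  have hνA : ν.real A = π.real (Prod.snd ⁻¹' A) := by
    rw [← h2, measureReal_def, measureReal_def, Measure.map_apply measurable_snd hA]
  have hsub : Prod.fst ⁻¹' A ⊆ Prod.snd ⁻¹' A ∪ B := by
    intro p hp
    by_cases hpB : p ∈ B
    · exact Or.inr hpB
    · left
      show p.2 ∈ A
      rw [← hBd p hpB]
      exact hp
  have hle := (measureReal_mono hsub (measure_ne_top π _)).trans (measureReal_union_le (Prod.snd ⁻¹' A) B)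
  have hB : π.real B = (π B).toReal := rfl
  linarith

/-- ★ **COMPOSITION OF COUPLINGS THROUGH THE EVENT CURRENCY** (the «K-fold composition lemma», with no level transport and no
gluing/disintegration): probability laws `ρ_0, …, ρ_n` on a space with measurable diagonal, consecutive ones coupled with bad masses
`≤ b_j` (`j < n`), admit a probability coupling of `ρ_0` and `ρ_n` with off-diagonal mass `≤ Σ_{j<n} b_j` (telescoping
`measureReal_sub_le_of_coupling`, then the maximal coupling `exists_coupling_of_measureReal_sub_le`). (Folklore.) -/
theorem exists_coupling_chain (hΔ : MeasurableSet (diagonal X)) (ρ : ℕ → Measure X) [∀ j, IsProbabilityMeasure (ρ j)]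
    (b : ℕ → ℝ) (n : ℕ)
    (h : ∀ j, j < n → ∃ (π : Measure (X × X)) (B : Set (X × X)), IsProbabilityMeasure π ∧ π.map Prod.fst = ρ j ∧
      π.map Prod.snd = ρ (j + 1) ∧ (∀ p, p ∉ B → p.1 = p.2) ∧ (π B).toReal ≤ b j) :
    ∃ π : Measure (X × X), IsProbabilityMeasure π ∧ π.map Prod.fst = ρ 0 ∧ π.map Prod.snd = ρ n ∧
      (π (diagonal X)ᶜ).toReal ≤ ∑ j ∈ Finset.range n, b j := by
  refine exists_coupling_of_measureReal_sub_le hΔ (ρ 0) (ρ n) fun A hA => ?_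
  have key : ∀ m, m ≤ n → (ρ 0).real A - (ρ m).real A ≤ ∑ j ∈ Finset.range m, b j := by
    intro m hm
    induction m with
    | zero => simp
    | succ m ih =>
      obtain ⟨π, B, hπ, h1, h2, hBd, hb⟩ := h m (Nat.lt_of_succ_le hm)
      have hstep := measureReal_sub_le_of_coupling (ρ m) (ρ (m + 1)) π B h1 h2 hBd hA
      rw [Finset.sum_range_succ]
      linarith [ih (Nat.le_of_succ_le hm)]
  exact key n le_rfl

end Chain

/-- **The instance on the unit field space** of a three-torus family: a chain of probability laws on `SU(2)^{bonds}` with consecutive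
couplings of bad masses `≤ b_j` composes to a coupling of its ends with off-diagonal mass `≤ Σ_{j<n} b_j` and the off-diagonal as a
MEASURABLE bad set (the shape `OneStepCoupling` asks for). -/
theorem exists_coupling_chain_unitSpace (F : T3Family) (ρ : ℕ → Measure (UnitSpace F)) [∀ j, IsProbabilityMeasure (ρ j)]
    (b : ℕ → ℝ) (n : ℕ)
    (h : ∀ j, j < n → ∃ (π : Measure (UnitSpace F × UnitSpace F)) (B : Set (UnitSpace F × UnitSpace F)),
      IsProbabilityMeasure π ∧ π.map Prod.fst = ρ j ∧ π.map Prod.snd = ρ (j + 1) ∧ (∀ p, p ∉ B → p.1 = p.2) ∧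
      (π B).toReal ≤ b j) :
    ∃ (π : Measure (UnitSpace F × UnitSpace F)) (B : Set (UnitSpace F × UnitSpace F)), IsProbabilityMeasure π ∧
      π.map Prod.fst = ρ 0 ∧ π.map Prod.snd = ρ n ∧ MeasurableSet B ∧ (∀ p, p ∉ B → p.1 = p.2) ∧
      (π B).toReal ≤ ∑ j ∈ Finset.range n, b j := by
  have hΔ := measurableSet_diagonal_unitSpace F
  obtain ⟨π, hπ, h1, h2, hoff⟩ := exists_coupling_chain hΔ ρ b n h
  exact ⟨π, (diagonal (UnitSpace F))ᶜ, hπ, h1, h2, hΔ.compl, fun p hp => mem_diagonal_iff.1 (notMem_compl_iff.1 hp), hoff⟩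

end Summit.QuantumFields.YangMills.Theorems.WindowCondCauchyCoupling
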